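import Summits.Langlands.Langlands.Statement
import Summits.Langlands.Langlands.Theorems.IrreducibilityBySelfDualityIrreducibleGL3CMContinuousSemisimplification
import Summits.Langlands.Langlands.Theorems.IrreducibilityBySelfDualityIrreducibleGL3CMReducibleCompanion
import Literature.NumberTheory.GaloisRepresentations.LAdicRepFrobenius
import Literature.NumberTheory.GaloisRepresentations.FramedRepEquivConj
import Literature.NumberTheory.Automorphic.ChebotarevArtinRepHolds
import Literature.NumberTheory.Automorphic.AutomorphicRepsGLSatakeFlathProofs
import HarnessLib

/-!
# Chebotarev–Brauer–Nesbitt transfer of irreducibility between avatars of one `π`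
(support item stmt-Langlands-14329 `IrreducibilityBySelfDuality.IrreducibleOffSector`, route
`route-Langlands-IrreducibilityBySelfDuality`; `--supports` file, does NOT import the Theses file)

The item `IrreducibleOffSector` ("the rest of the mountain, part 2", Ramakrishnan's expectation
*cuspidal ⇒ irreducible* off the sector `n = 3 ∧ K CM ∧ regular`) quantifies over EVERY
`ρ : Γ_K →ₜ* GL_n(ℚ̄_ℓ)` that is Satake–Frobenius compatible with `(π, ι)` at almost all places
(`Summit.Langlands.SatakeFrobCompatibleAt`, L-normalisation `arithFrobPolyOfSatake ι q_v 1 α`), not over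
a constructed `ρ_{π,ι}`.  This file proves, in every rank and over every number field, the standard
transfer that reduces the item to the existence of ONE irreducible compatible avatar:

* `isIrreducible_of_eventually_hasFrobCharpolyAt_common` (Galois form) — if `ρ₀` is irreducible and
  `ρ₀`, `ρ` are unramified with a common Frobenius characteristic polynomial at almost all places, then
  `ρ` is irreducible.  Proof: a continuous semisimplification `r` of `ρ`
  (`IrreducibleGL3CM.stub_continuousSemisimplification`, every rank: same characteristic polynomials,
  `ker ρ ≤ ker r`) satisfies the same hypothesis; `ρ₀` and `r` are semisimple, hence equivalent
  (Chebotarev + Brauer–Nesbitt, `FramedGaloisRep.nonempty_equiv_of_hasFrobCharpolyAt_eventually` fed with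
  the PROVED `chebotarev_artinRep_holds`), hence conjugate (`FramedRep.exists_eq_conj_of_equiv`), so
  `det(X - ρ(g)) = det(X - r(g)) = det(X - ρ₀(g))` for all `g`, and reducibility of `ρ` would pass to
  `ρ₀` (Brauer–Nesbitt with characteristic polynomials, `IrreducibleGL3CM.stub_not_isIrreducible_of_charpoly_eq`).
* `isIrreducible_of_satakeFrobCompatible` (automorphic form) — the same for `ρ₀`, `ρ` both
  Satake–Frobenius compatible with `(π, ι)` at almost all places (Satake parameters are unique,
  `AutomorphicRepData.hasSatakeParamAt_unique_holds`, Flath, so the Frobenius polynomials are common).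
* `isIrreducible_of_forall_isSemisimple` — it suffices to prove the item for SEMISIMPLE `ρ`;
  `eventually_forall_satake_of_satakeFrobCompatibleAt` — the item's `∃ α` clause gives the `∀ α`
  clause of the route's cruxes at almost all places.
* `isIrreducible_of_automorphicToGalois` — consequently clause (A) of the summit for `(n, K, hcpt)`
  (`Summit.Langlands.AutomorphicToGalois n 𝓡 hcpt`, which provides an irreducible compatible `ρ_{π,ι}`)
  already gives the conclusion of `IrreducibleOffSector` for that `(n, K, hcpt)` — for every `π`,
  in or off the sector: the item is implied by the summit ("implied by the summit via
  Chebotarev–Brauer–Nesbitt", as its docstring says), which is the sanity check that the repaired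
  item (guard `0 < n`) is not stronger than the mountain.
* `isIrreducible_of_rank_one` — the slice `n = 1` of the item holds outright (a line has no proper
  non-zero subspace).

References: P. Deligne, J.-P. Serre, *Formes modulaires de poids 1*, ASENS 7 (1974), Lemme 3.2 and
6.12; N. Bourbaki, *Algèbre* VIII, § 20 n° 6; D. Ramakrishnan, *Irreducibility and cuspidality*
(2008), Introduction.
-/

noncomputable section

-- `Summit.Langlands.Langlands.…` (summit = sub-problem name, D-0017 layout) trips `dupNamespace` on
-- every declaration; the project-wide lakefile option is repeated here for stand-alone elaboration.
set_option linter.dupNamespace false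

-- (H5 of `AutomorphicRepsGL`) the place subtypes indexing the factors of `mixedSpace K` are `Fintype`
-- classically
open scoped NumberField Classical
open Filter IsDedekindDomain
open Literature.NumberTheory.Automorphic Literature.NumberTheory.GaloisRepresentations

namespace Summit.Langlands.Langlands.Theorems.IrreducibleOffSector

variable {n : ℕ} {K : Type} [Field K] [NumberField K] {hcpt : isCompact_glFiniteIntegralLevel n K}
  {ℓ : ℕ} [Fact ℓ.Prime]

omit [NumberField K] in
/-- An irreducible continuous Galois representation on `ℚ̄_ℓⁿ` is semisimple (a simple lattice of
subrepresentations is complemented). [folklore] -/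
theorem isSemisimple_of_isIrreducible (ρ : FramedGaloisRep K (PadicAlgCl ℓ) n)
    (h : ρ.toGaloisRep.IsIrreducible) : ρ.toGaloisRep.IsSemisimple := by
  haveI := h
  change ComplementedLattice _
  infer_instance

omit [NumberField K] in
/-- Conjugate framed representations have the same characteristic polynomials
(Mathlib `Matrix.charpoly_units_conj`). [folklore] -/
theorem charpoly_conj (P : GL (Fin n) (PadicAlgCl ℓ)) (ρ : FramedGaloisRep K (PadicAlgCl ℓ) n)
    (g : Field.absoluteGaloisGroup K) :
    FramedRep.charpoly (ρ.conj P) g = FramedRep.charpoly ρ g := by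
  simp only [FramedRep.charpoly, FramedRep.conj_apply, Units.val_mul, Matrix.coe_units_inv]
  exact Matrix.charpoly_units_conj P _

/-- **A continuous semisimplification of an a.e.-compatible avatar is a.e.-compatible.**  If `ρ` is
Satake–Frobenius compatible with `(π, ι)` at almost all places, so is every `r` with the same
characteristic polynomials and `ker ρ ≤ ker r` (unramifiedness and Frobenius characteristic
polynomials are read off `ρ(σ) = 1` on inertia and `det(X - ρ(σ))` at Frobenii). [folklore] -/
theorem eventually_satakeFrobCompatibleAt_of_charpoly_eq
    (π : AutomorphicRepData (AutomorphyDatum.gl n K hcpt)) (ι : PadicAlgCl ℓ ≃+* ℂ)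
    {ρ r : FramedGaloisRep K (PadicAlgCl ℓ) n}
    (hcp : ∀ g, FramedRep.charpoly r g = FramedRep.charpoly ρ g) (hker : ∀ g, ρ g = 1 → r g = 1)
    (hc : ∀ᶠ v : HeightOneSpectrum (𝓞 K) in cofinite, SatakeFrobCompatibleAt ι π ρ v) :
    ∀ᶠ v : HeightOneSpectrum (𝓞 K) in cofinite, SatakeFrobCompatibleAt ι π r v := by
  filter_upwards [hc] with v hv
  obtain ⟨α, hα, hur, hcpv⟩ := hv
  exact ⟨α, hα, fun 𝔓 h𝔓 σ hσ => hker σ (hur 𝔓 h𝔓 σ hσ),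
    fun 𝔓 h𝔓 σ hσ => (hcp σ).trans (hcpv 𝔓 h𝔓 σ hσ)⟩

/-- **Two avatars of one `π` have equal Frobenius characteristic polynomials almost everywhere**:
if `ρ₀` and `r` are both Satake–Frobenius compatible with `(π, ι)` at almost all places, then at
almost all `v` both are unramified with a common characteristic polynomial of arithmetic Frobenius
(Satake parameters are unique: `hasSatakeParamAt_unique_holds`, Flath 1979 Thm. 3). [folklore] -/
theorem eventually_hasFrobCharpolyAt_common
    (π : AutomorphicRepData (AutomorphyDatum.gl n K hcpt)) (ι : PadicAlgCl ℓ ≃+* ℂ)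
    {ρ₀ r : FramedGaloisRep K (PadicAlgCl ℓ) n}
    (h₀ : ∀ᶠ v : HeightOneSpectrum (𝓞 K) in cofinite, SatakeFrobCompatibleAt ι π ρ₀ v)
    (hr : ∀ᶠ v : HeightOneSpectrum (𝓞 K) in cofinite, SatakeFrobCompatibleAt ι π r v) :
    ∀ᶠ v : HeightOneSpectrum (𝓞 K) in cofinite,
      ρ₀.IsUnramifiedAt v ∧ r.IsUnramifiedAt v ∧
        ∃ P : Polynomial (PadicAlgCl ℓ), ρ₀.HasFrobCharpolyAt v P ∧ r.HasFrobCharpolyAt v P := by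
  filter_upwards [h₀, hr] with v hv hv'
  obtain ⟨α, hα, hur, hcp⟩ := hv
  obtain ⟨α', hα', hur', hcp'⟩ := hv'
  obtain rfl : α = α' := AutomorphicRepData.hasSatakeParamAt_unique_holds π hα hα'
  exact ⟨hur, hur', _, hcp, hcp'⟩

/-- **Chebotarev–Brauer–Nesbitt transfer of irreducibility, Galois form** (every rank `n`, every
number field `K`).  Let `ρ₀, ρ : Γ_K →ₜ* GL_n(ℚ̄_ℓ)` be continuous, both unramified with a COMMON
characteristic polynomial of arithmetic Frobenius at all but finitely many places.  If `ρ₀` is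
irreducible, so is `ρ` (no semisimplicity assumed on `ρ`): a continuous semisimplification `r` of `ρ`
(same characteristic polynomials, `ker ρ ≤ ker r`) satisfies the same hypothesis, hence is equivalent to
the semisimple `ρ₀` (Deligne–Serre 1974, Lemme 3.2: Chebotarev + Brauer–Nesbitt), hence conjugate to
it, so `ρ` and `ρ₀` have the same characteristic polynomials everywhere and reducibility of `ρ` would
force that of `ρ₀` (Brauer–Nesbitt with characteristic polynomials, Bourbaki A VIII § 20 n° 6).
[cite: DeligneSerreASENS1974, Lemme 3.2] -/
theorem isIrreducible_of_eventually_hasFrobCharpolyAt_common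
    {ρ₀ ρ : FramedGaloisRep K (PadicAlgCl ℓ) n} (hirr₀ : ρ₀.toGaloisRep.IsIrreducible)
    (h : ∀ᶠ v : HeightOneSpectrum (𝓞 K) in cofinite,
      ρ₀.IsUnramifiedAt v ∧ ρ.IsUnramifiedAt v ∧
        ∃ P : Polynomial (PadicAlgCl ℓ), ρ₀.HasFrobCharpolyAt v P ∧ ρ.HasFrobCharpolyAt v P) :
    ρ.toGaloisRep.IsIrreducible := by
  -- a continuous semisimplification `r` of `ρ`, with the same hypothesis
  obtain ⟨r, hrss, hrcp, hrker⟩ := IrreducibleGL3CM.stub_continuousSemisimplification K ℓ n ρ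
  have hr : ∀ᶠ v : HeightOneSpectrum (𝓞 K) in cofinite,
      ρ₀.IsUnramifiedAt v ∧ r.IsUnramifiedAt v ∧
        ∃ P : Polynomial (PadicAlgCl ℓ), ρ₀.HasFrobCharpolyAt v P ∧ r.HasFrobCharpolyAt v P := by
    filter_upwards [h] with v hv
    obtain ⟨hur₀, hur, P, hcp₀, hcp⟩ := hv
    exact ⟨hur₀, fun 𝔓 h𝔓 σ hσ => hrker σ (hur 𝔓 h𝔓 σ hσ), P, hcp₀,
      fun 𝔓 h𝔓 σ hσ => (hrcp σ).trans (hcp 𝔓 h𝔓 σ hσ)⟩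
  -- `ρ₀ ≃ r` (Chebotarev + Brauer–Nesbitt), hence `r` is a conjugate of `ρ₀`
  obtain ⟨e⟩ := FramedGaloisRep.nonempty_equiv_of_hasFrobCharpolyAt_eventually
    chebotarev_artinRep_holds ρ₀ r (isSemisimple_of_isIrreducible ρ₀ hirr₀) hrss hr
  obtain ⟨P, hP⟩ := FramedRep.exists_eq_conj_of_equiv ρ₀ r e
  -- equal characteristic polynomials everywhere, and Brauer–Nesbitt
  have hcp : ∀ g, FramedRep.charpoly ρ₀ g = FramedRep.charpoly ρ g := fun g => by
    rw [← hrcp g, hP, charpoly_conj]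
  by_contra hirr
  exact IrreducibleGL3CM.stub_not_isIrreducible_of_charpoly_eq K ℓ n ρ ρ₀
    (isSemisimple_of_isIrreducible ρ₀ hirr₀) hcp hirr hirr₀

/-- **Chebotarev–Brauer–Nesbitt transfer of irreducibility, automorphic form** (every rank `n`,
every number field `K`).  Let `π` be an automorphic representation datum of `GL_n(𝔸_K)`,
`ι : ℚ̄_ℓ ≃+* ℂ`, and let `ρ₀, ρ : Γ_K →ₜ* GL_n(ℚ̄_ℓ)` both be Satake–Frobenius compatible with
`(π, ι)` at almost all places (`SatakeFrobCompatibleAt`).  If `ρ₀` is irreducible, so is `ρ`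
(`isIrreducible_of_eventually_hasFrobCharpolyAt_common` with `eventually_hasFrobCharpolyAt_common`).
[cite: DeligneSerreASENS1974, Lemme 3.2] -/
theorem isIrreducible_of_satakeFrobCompatible
    (π : AutomorphicRepData (AutomorphyDatum.gl n K hcpt)) (ι : PadicAlgCl ℓ ≃+* ℂ)
    {ρ₀ ρ : FramedGaloisRep K (PadicAlgCl ℓ) n} (hirr₀ : ρ₀.toGaloisRep.IsIrreducible)
    (h₀ : ∀ᶠ v : HeightOneSpectrum (𝓞 K) in cofinite, SatakeFrobCompatibleAt ι π ρ₀ v)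
    (hρ : ∀ᶠ v : HeightOneSpectrum (𝓞 K) in cofinite, SatakeFrobCompatibleAt ι π ρ v) :
    ρ.toGaloisRep.IsIrreducible :=
  isIrreducible_of_eventually_hasFrobCharpolyAt_common hirr₀
    (eventually_hasFrobCharpolyAt_common π ι h₀ hρ)

/-- **It suffices to treat semisimple avatars.**  If every SEMISIMPLE `r : Γ_K →ₜ* GL_n(ℚ̄_ℓ)`
Satake–Frobenius compatible with `(π, ι)` at almost all places is irreducible, then so is every
compatible `ρ`: a continuous semisimplification `r` of `ρ` is compatible a.e.
(`eventually_satakeFrobCompatibleAt_of_charpoly_eq`), hence irreducible, and it has the characteristic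
polynomials of `ρ`, so `ρ` is irreducible (Brauer–Nesbitt with characteristic polynomials,
`IrreducibleGL3CM.stub_not_isIrreducible_of_charpoly_eq`).  (The a.e.-clause of `IrreducibleOffSector`
may thus be restricted to semisimple `ρ` without loss.) [folklore] -/
theorem isIrreducible_of_forall_isSemisimple
    (π : AutomorphicRepData (AutomorphyDatum.gl n K hcpt)) (ι : PadicAlgCl ℓ ≃+* ℂ)
    (h : ∀ r : FramedGaloisRep K (PadicAlgCl ℓ) n, r.toGaloisRep.IsSemisimple →
      (∀ᶠ v : HeightOneSpectrum (𝓞 K) in cofinite, SatakeFrobCompatibleAt ι π r v) →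
        r.toGaloisRep.IsIrreducible)
    (ρ : FramedGaloisRep K (PadicAlgCl ℓ) n)
    (hρ : ∀ᶠ v : HeightOneSpectrum (𝓞 K) in cofinite, SatakeFrobCompatibleAt ι π ρ v) :
    ρ.toGaloisRep.IsIrreducible := by
  obtain ⟨r, hrss, hrcp, hrker⟩ := IrreducibleGL3CM.stub_continuousSemisimplification K ℓ n ρ
  have hirr : r.toGaloisRep.IsIrreducible :=
    h r hrss (eventually_satakeFrobCompatibleAt_of_charpoly_eq π ι hrcp hrker hρ)
  by_contra hρirr
  exact IrreducibleGL3CM.stub_not_isIrreducible_of_charpoly_eq K ℓ n ρ r hrss hrcp hρirr hirr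

/-- **From the summit's `∃ α` clause to the cruxes' `∀ α` clause.**  If `ρ` is Satake–Frobenius
compatible with `(π, ι)` at almost all places, then at almost all places, for EVERY Satake parameter
`α` of `π` at `v`, `ρ` is unramified with Frobenius characteristic polynomial
`arithFrobPolyOfSatake ι q_v 1 α` (Satake parameters are unique, `hasSatakeParamAt_unique_holds`).
[cite: FlathCorvallis1979, Thm. 3] -/
theorem eventually_forall_satake_of_satakeFrobCompatibleAt
    (π : AutomorphicRepData (AutomorphyDatum.gl n K hcpt)) (ι : PadicAlgCl ℓ ≃+* ℂ)
    {ρ : FramedGaloisRep K (PadicAlgCl ℓ) n}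
    (hρ : ∀ᶠ v : HeightOneSpectrum (𝓞 K) in cofinite, SatakeFrobCompatibleAt ι π ρ v) :
    ∀ᶠ v : HeightOneSpectrum (𝓞 K) in cofinite, ∀ α : Multiset ℂ, π.HasSatakeParamAt v α →
      ρ.IsUnramifiedAt v ∧ ρ.HasFrobCharpolyAt v (arithFrobPolyOfSatake ι v.residueCard 1 α) := by
  filter_upwards [hρ] with v hv α hα
  obtain ⟨α₀, hα₀, hur, hcp⟩ := hv
  obtain rfl : α = α₀ := AutomorphicRepData.hasSatakeParamAt_unique_holds π hα hα₀
  exact ⟨hur, hcp⟩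

/-- **The summit's clause (A) at `(n, K, hcpt)` gives the conclusion of `IrreducibleOffSector` at
`(n, K, hcpt)`** — for every L-algebraic cuspidal `π`, in or off the sector: clause (A)
(`Summit.Langlands.AutomorphicToGalois n 𝓡 hcpt`) provides an irreducible `ρ_{π,ι}` corresponding to
`π`, in particular Satake–Frobenius compatible a.e. (`Corresponds`, first conjunct), and
irreducibility transfers to every a.e.-compatible `ρ` (`isIrreducible_of_satakeFrobCompatible`).
This is the kernel check of the item's gloss "implied by the summit via Chebotarev–Brauer–Nesbitt".
[cite: DeligneSerreASENS1974, Lemme 3.2] -/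
theorem isIrreducible_of_automorphicToGalois (hcpt : isCompact_glFiniteIntegralLevel n K)
    {𝓡 : ReciprocityData K} (hA : AutomorphicToGalois n 𝓡 hcpt)
    (π : CuspidalAutomorphicRepData n K hcpt) (hL : π.1.IsLAlgebraic) (ℓ : ℕ) [Fact ℓ.Prime]
    (ι : PadicAlgCl ℓ ≃+* ℂ) (ρ : FramedGaloisRep K (PadicAlgCl ℓ) n)
    (hρ : ∀ᶠ v : HeightOneSpectrum (𝓞 K) in cofinite, SatakeFrobCompatibleAt ι π.1 ρ v) :
    ρ.toGaloisRep.IsIrreducible := by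
  obtain ⟨ρ₀, hirr₀, -, hcorr₀, -⟩ := hA π hL ℓ ι
  exact isIrreducible_of_satakeFrobCompatible π.1 ι hirr₀ hcorr₀.1 hρ

/-- **The summit implies the item's conclusion at every `(n, K, hcpt)` with `0 < n`** (and for
every `π`, the sector hypothesis being unused): unfold `Langlands` — its non-vacuity conjunct
`Nonempty (ReciprocityData K)` gives a datum `𝓡`, and its clause (A) holds for every `𝓡` (revised
summit p141787, `∀ F, Nonempty (ReciprocityData F) ∧ ∀ 𝓡 n, …`) — and apply
`isIrreducible_of_automorphicToGalois`. [cite: BuzzardGeeLMS2014, Conj. 3.2.1 and Conj. 3.2.2] -/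
theorem isIrreducible_of_langlands (hLang : _root_.Langlands) (hn : 0 < n)
    (hcpt : isCompact_glFiniteIntegralLevel n K) (π : CuspidalAutomorphicRepData n K hcpt)
    (hL : π.1.IsLAlgebraic) (ℓ : ℕ) [Fact ℓ.Prime] (ι : PadicAlgCl ℓ ≃+* ℂ)
    (ρ : FramedGaloisRep K (PadicAlgCl ℓ) n)
    (hρ : ∀ᶠ v : HeightOneSpectrum (𝓞 K) in cofinite, SatakeFrobCompatibleAt ι π.1 ρ v) :
    ρ.toGaloisRep.IsIrreducible := by
  obtain ⟨⟨𝓡⟩, h𝓡⟩ := hLang K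
  exact isIrreducible_of_automorphicToGalois hcpt (h𝓡 𝓡 n hn hcpt).1 π hL ℓ ι ρ hρ

omit [NumberField K] in
/-- **Rank one**: every continuous `ρ : Γ_K →ₜ* GL₁(ℚ̄_ℓ)` is irreducible (the lattice of
subrepresentations of a line is `{⊥, ⊤}` with `⊥ ≠ ⊤`), so the slice `n = 1` of
`IrreducibleOffSector` holds unconditionally. [folklore] -/
theorem isIrreducible_of_rank_one (ρ : FramedGaloisRep K (PadicAlgCl ℓ) 1) :
    ρ.toGaloisRep.IsIrreducible := by
  change IsSimpleOrder (Subrepresentation (FramedRep.toRepresentation ρ))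
  -- the lattice of subspaces of the line `ℚ̄_ℓ¹` is `{⊥, ⊤}`
  haveI hV : IsSimpleOrder (Submodule (PadicAlgCl ℓ) (Fin 1 → PadicAlgCl ℓ)) :=
    is_simple_module_of_finrank_eq_one (Module.finrank_fin_fun (PadicAlgCl ℓ))
  have hbot : (⊥ : Subrepresentation (FramedRep.toRepresentation ρ)).toSubmodule = ⊥ := rfl
  have htop : (⊤ : Subrepresentation (FramedRep.toRepresentation ρ)).toSubmodule = ⊤ := rfl
  haveI : Nontrivial (Subrepresentation (FramedRep.toRepresentation ρ)) := by
    refine ⟨⟨⊥, ⊤, fun h => ?_⟩⟩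
    have h' := congrArg Subrepresentation.toSubmodule h
    rw [hbot, htop] at h'
    exact bot_ne_top h'
  refine ⟨fun W => ?_⟩
  rcases hV.2 W.toSubmodule with h | h
  · exact Or.inl (Subrepresentation.toSubmodule_injective (h.trans hbot.symm))
  · exact Or.inr (Subrepresentation.toSubmodule_injective (h.trans htop.symm))

end Summit.Langlands.Langlands.Theorems.IrreducibleOffSector

end
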